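import Summits.ABC.StewartYu.PadicG3TwoThirdSizes
import Summits.ABC.StewartYu.PadicTwoSatData
import HarnessLib

/-!
# Cell abc-stewartyu, WP-L.P(2) (crux r4 `PadicCoreTwoRat`, stmt-ABC-20504), layer K3: the CLASS VECTOR of the
# third step cleared with an ABSTRACT datum for the rational parts `qPart3 κᵢ s`, and the datum supplied from the
# VIRTUAL box of the 𝔑-threaded family

`Summits/ABC/StewartYu/PadicG3TwoThirdSizesSat.lean` — cell `abc-stewartyu` (HOME `run/shared/lean/pub/abc-stewartyu/`),
route `YuMatveevShapeRat`, seat p3 (g9, WP-L.P(2) lead; design memo HOME/p3/memo-11 §2 row «third-step sizes», §4 K3).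
Theorems on `TwoSetup` and three `ℕ`-valued definitions on `TwoSetup.SatData`; no named fact.

The landed `PadicG3TwoThirdSizes` clears the rational part `qPart3 κᵢ s = ∏ₖ allₖ^{⌊κᵢₖ s/3⌋}` of a third-point value
with `monDen all (thirdBox (Dbox I) (Dθ I) s)` (coordinate box).  On the 𝔑-threaded family the quotient vector
`⌊κ s/3⌋ = (κ s − r)/3` (`r = κ s mod 3 ∈ {0,1,2}^{d+1}`) has VIRTUAL exponents
`((κ s − r) ᵥ* U)/3`, bounded by `(|s|·Bvⱼ + 2·Ucolⱼ)/3` where `Σₖ |U k j| ≤ Ucolⱼ` (the α-coordinates of the basis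
vectors — the reduced-basis slot, R25 (3) `SatBasisReduced`), and is cleared by `SatCoords` with the same numerator
shape.  This file gives

* `exists_int_clear_mul_third_coef_gen`, `exists_int_clear_mul_thirdVec_gen`, **`sum_abs_thirdVec_le_gen`** — the
  landed clearing/size lemmas of the class vector with the `qPart3` line on an abstract datum `Dm₃`, `Mm₃`;
* on `SatData`: `Eof`/`DmOf` (the clearing denominator of an arbitrary virtual bound `W`, `log DmOf ≤ 2Σ(Wⱼ/N + 1)·Vⱼ`),
  `W3 Bv Ucol s` (the virtual bound of the quotient vector), **`exists_int_Dm3_mul_qPart3`** and the family form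
  **`thirdDatum_of_vbox`** (= the hypothesis `hm₃` above with `Mm₃ = Dm₃²`).

WHAT THIS IS NOT: no third step (sequel `PadicG3TwoThirdStepSat`), no numbers; no crux moves (A1.L not moved).

References: K. Yu, Acta Math. 211 (2013), (5.35)–(5.39), Lemma 5.4; Yu. V. Nesterenko, LNM 1819 (2003), §4.3
(4.42)–(4.44), Lemma 3.11; HOME/p3/memo-11 §1 (M2)–(M3), §4 K3.
-/

noncomputable section

open Finset Polynomial
open scoped Matrix
open Literature.NumberTheory.Transcendental
open Literature.NumberTheory.Transcendental.CW77.Setup (Tau tauNorm)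

namespace Summit.ABC.StewartYu

namespace TwoSetup

variable (S : TwoSetup) {ι : Type*} (R : ι → ℚ[X]) (u : ι → Fin S.d → ℤ) (uθ : ι → ℤ)

/-! ### One coefficient and the class sums cleared on an abstract `qPart3` datum -/

/-- **One coefficient of a class sum cleared** (abstract datum): with `den₃·(Hasse_{t₀} Rᵢ)(s/3) = z₀ ∈ ℤ`,
`|z₀| ≤ M₃`, `|𝔛ⱼ(i)| ≤ Xb` and `Dm₃·qPart3 κᵢ s = z₂ ∈ ℤ`, `|z₂| ≤ Mm₃`:
`(den₃·|b_θ|^{|t|}·Dm₃)·[(Hasse_{t₀} Rᵢ)(s/3)·∏ zγⱼ^{tⱼ}·qPart3 κᵢ s] ∈ ℤ`, `|·| ≤ M₃·Xb^{|t|}·Mm₃`.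
[cite: Yu2013, (5.35); shape only] -/
theorem exists_int_clear_mul_third_coef_gen (i : ι) (τ : Tau S.d) (s : ℤ) {den₃ : ℕ} {M₃ : ℤ}
    (hR : ∃ z₀ : ℤ, (den₃ : ℚ) * (hasseDeriv τ.1 (R i)).eval ((s : ℚ) / 3) = z₀ ∧ |z₀| ≤ M₃)
    {Xb : ℤ} (hX : ∀ j, |S.dirScalar (u i) (uθ i) j| ≤ Xb) {Dm₃ : ℕ} {Mm₃ : ℤ}
    (hm₃ : ∃ z₂ : ℤ, ((Dm₃ : ℕ) : ℚ) * S.qPart3 (Fin.snoc (u i) (uθ i)) s = z₂ ∧ |z₂| ≤ Mm₃) :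
    ∃ z : ℤ, ((den₃ * S.bθ.natAbs ^ (∑ j, τ.2 j) * Dm₃ : ℕ) : ℚ) *
        ((hasseDeriv τ.1 (R i)).eval ((s : ℚ) / 3) * S.zγpow u uθ i τ.2 *
          S.qPart3 (Fin.snoc (u i) (uθ i)) s) = z ∧
      |z| ≤ M₃ * Xb ^ (∑ j, τ.2 j) * Mm₃ := by
  -- the landed `exists_int_clear_mul_third_coef` with the `qPart3` line swapped
  obtain ⟨z₀, hz₀, hz₀le⟩ := hR
  obtain ⟨z₂, hz₂, hz₂le⟩ := hm₃
  set z₁ : ℤ := ∏ j, S.dirScalar (u i) (uθ i) j ^ τ.2 j with hz₁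
  have hz₁q : ((S.bθ.natAbs ^ (∑ j, τ.2 j) : ℕ) : ℚ) * S.zγpow u uθ i τ.2 =
      (S.bθ.sign : ℚ) ^ (∑ j, τ.2 j) * z₁ := by
    have hsgn : ((S.bθ.natAbs : ℕ) : ℚ) = (S.bθ.sign : ℚ) * S.bθ := by
      rw [Nat.cast_natAbs]; push_cast
      rw [← Int.cast_abs, ← Int.sign_mul_self_eq_abs]; push_cast; ring
    push_cast
    rw [hsgn, mul_pow, mul_assoc, S.bθ_pow_mul_zγpow, hz₁]
    push_cast; ring
  have hz₁le : |z₁| ≤ Xb ^ (∑ j, τ.2 j) := S.abs_prod_dirScalar_pow_le u uθ i τ.2 hX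
  have hsgn1 : |(S.bθ.sign : ℤ) ^ (∑ j, τ.2 j)| = 1 := by
    rw [abs_pow]
    have : |S.bθ.sign| = 1 := by
      rcases lt_or_gt_of_ne S.bθ_ne with h | h
      · rw [Int.sign_eq_neg_one_of_neg h]; rfl
      · rw [Int.sign_eq_one_of_pos h]; rfl
    rw [this, one_pow]
  refine ⟨z₀ * (S.bθ.sign ^ (∑ j, τ.2 j) * z₁) * z₂, ?_, ?_⟩
  · push_cast
    have e2 := hz₁q
    have e3 := hz₂
    push_cast at e2 e3
    calc ((den₃ : ℚ) * ((S.bθ.natAbs : ℕ) : ℚ) ^ (∑ j, τ.2 j) * (Dm₃ : ℚ)) *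
          ((hasseDeriv τ.1 (R i)).eval ((s : ℚ) / 3) * S.zγpow u uθ i τ.2 *
            S.qPart3 (Fin.snoc (u i) (uθ i)) s)
        = ((den₃ : ℚ) * (hasseDeriv τ.1 (R i)).eval ((s : ℚ) / 3)) *
          ((((S.bθ.natAbs : ℕ) : ℚ) ^ (∑ j, τ.2 j)) * S.zγpow u uθ i τ.2) *
          ((Dm₃ : ℚ) * S.qPart3 (Fin.snoc (u i) (uθ i)) s) := by ring
      _ = (z₀ : ℚ) * ((S.bθ.sign : ℚ) ^ (∑ j, τ.2 j) * z₁) * z₂ := by rw [hz₀, e2, e3]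
  · have h0 : (0 : ℤ) ≤ M₃ := (abs_nonneg _).trans hz₀le
    rw [abs_mul, abs_mul, abs_mul, hsgn1, one_mul]
    have hXb : (0 : ℤ) ≤ Xb ^ (∑ j, τ.2 j) := (abs_nonneg _).trans hz₁le
    calc |z₀| * |z₁| * |z₂| ≤ M₃ * Xb ^ (∑ j, τ.2 j) * |z₂| := by
          refine mul_le_mul_of_nonneg_right ?_ (abs_nonneg _)
          exact mul_le_mul hz₀le hz₁le (abs_nonneg _) h0
      _ ≤ M₃ * Xb ^ (∑ j, τ.2 j) * Mm₃ := mul_le_mul_of_nonneg_left hz₂le (mul_nonneg h0 hXb)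

/-- **Every class sum cleared by the common denominator** `D = den₃·|b_θ|^{|t|}·Dm₃` (abstract datum):
`D·thirdVec r ∈ ℤ`, `|D·thirdVec r| ≤ #B_r·P·M₃·Xb^{|t|}·Mm₃`. [cite: Yu2013, (5.35)–(5.39); shape only] -/
theorem exists_int_clear_mul_thirdVec_gen (B : Finset ι) (p : ι → ℤ) (τ : Tau S.d) (s : ℤ) {den₃ : ℕ} {M₃ : ℤ}
    (hR : ∀ i ∈ B, ∃ z₀ : ℤ, (den₃ : ℚ) * (hasseDeriv τ.1 (R i)).eval ((s : ℚ) / 3) = z₀ ∧ |z₀| ≤ M₃)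
    {Xb : ℤ} (hX : ∀ i ∈ B, ∀ j, |S.dirScalar (u i) (uθ i) j| ≤ Xb) {P : ℤ} (hP : ∀ i ∈ B, |p i| ≤ P)
    {Dm₃ : ℕ} {Mm₃ : ℤ}
    (hm₃ : ∀ i ∈ B, ∃ z₂ : ℤ, ((Dm₃ : ℕ) : ℚ) * S.qPart3 (Fin.snoc (u i) (uθ i)) s = z₂ ∧ |z₂| ≤ Mm₃)
    (r : Fin (S.d + 1) → Fin 3) :
    ∃ z : ℤ, ((den₃ * S.bθ.natAbs ^ (∑ j, τ.2 j) * Dm₃ : ℕ) : ℚ) * S.thirdVec R u uθ B p τ s r = z ∧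
      |z| ≤ (B.filter (fun i => S.res3 (Fin.snoc (u i) (uθ i)) s = r)).card * P *
        (M₃ * Xb ^ (∑ j, τ.2 j) * Mm₃) := by
  classical
  set Br := B.filter (fun i => S.res3 (Fin.snoc (u i) (uθ i)) s = r) with hBr
  have hBrsub : ∀ i ∈ Br, i ∈ B := fun i hi => (Finset.mem_filter.mp hi).1
  have hcoef : ∀ i ∈ Br, ∃ z : ℤ, ((den₃ * S.bθ.natAbs ^ (∑ j, τ.2 j) * Dm₃ : ℕ) : ℚ) *
        ((hasseDeriv τ.1 (R i)).eval ((s : ℚ) / 3) * S.zγpow u uθ i τ.2 *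
          S.qPart3 (Fin.snoc (u i) (uθ i)) s) = z ∧
      |z| ≤ M₃ * Xb ^ (∑ j, τ.2 j) * Mm₃ :=
    fun i hi => S.exists_int_clear_mul_third_coef_gen R u uθ i τ s (hR i (hBrsub i hi)) (hX i (hBrsub i hi))
      (hm₃ i (hBrsub i hi))
  choose! z hz hzle using hcoef
  refine ⟨∑ i ∈ Br, p i * z i, ?_, ?_⟩
  · unfold thirdVec
    rw [← hBr, Finset.mul_sum]
    push_cast
    refine Finset.sum_congr rfl fun i hi => ?_
    have h := hz i hi
    push_cast at h
    calc ((den₃ : ℚ) * ((S.bθ.natAbs : ℕ) : ℚ) ^ (∑ j, τ.2 j) * (Dm₃ : ℚ)) *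
          ((p i : ℚ) * ((hasseDeriv τ.1 (R i)).eval ((s : ℚ) / 3) * S.zγpow u uθ i τ.2 *
            S.qPart3 (Fin.snoc (u i) (uθ i)) s))
        = (p i : ℚ) * (((den₃ : ℚ) * ((S.bθ.natAbs : ℕ) : ℚ) ^ (∑ j, τ.2 j) * (Dm₃ : ℚ)) *
          ((hasseDeriv τ.1 (R i)).eval ((s : ℚ) / 3) * S.zγpow u uθ i τ.2 *
            S.qPart3 (Fin.snoc (u i) (uθ i)) s)) := by ring
      _ = (p i : ℚ) * (z i : ℚ) := by rw [h]
  · calc |∑ i ∈ Br, p i * z i| ≤ ∑ i ∈ Br, |p i * z i| := Finset.abs_sum_le_sum_abs _ _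
      _ ≤ ∑ i ∈ Br, P * (M₃ * Xb ^ (∑ j, τ.2 j) * Mm₃) := by
          refine Finset.sum_le_sum fun i hi => ?_
          rw [abs_mul]
          have hP0 : (0 : ℤ) ≤ P := (abs_nonneg _).trans (hP i (hBrsub i hi))
          exact mul_le_mul (hP i (hBrsub i hi)) (hzle i hi) (abs_nonneg _) hP0
      _ = Br.card * P * (M₃ * Xb ^ (∑ j, τ.2 j) * Mm₃) := by
          rw [Finset.sum_const, nsmul_eq_mul]; ring

/-- **Size of the class vector on an abstract datum**: `∑ᵣ |thirdVec r| ≤ #B·P·M₃·Xb^{|t|}·Mm₃` (`den₃, Dm₃ ≥ 1`).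
[cite: Yu2013, (5.38); shape only] -/
theorem sum_abs_thirdVec_le_gen (B : Finset ι) (p : ι → ℤ) (τ : Tau S.d) (s : ℤ) {den₃ : ℕ}
    (hden₃ : 1 ≤ den₃) {M₃ : ℤ}
    (hR : ∀ i ∈ B, ∃ z₀ : ℤ, (den₃ : ℚ) * (hasseDeriv τ.1 (R i)).eval ((s : ℚ) / 3) = z₀ ∧ |z₀| ≤ M₃)
    {Xb : ℤ} (hX : ∀ i ∈ B, ∀ j, |S.dirScalar (u i) (uθ i) j| ≤ Xb) {P : ℤ} (hP : ∀ i ∈ B, |p i| ≤ P)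
    {Dm₃ : ℕ} (hDm₃ : 1 ≤ Dm₃) {Mm₃ : ℤ}
    (hm₃ : ∀ i ∈ B, ∃ z₂ : ℤ, ((Dm₃ : ℕ) : ℚ) * S.qPart3 (Fin.snoc (u i) (uθ i)) s = z₂ ∧ |z₂| ≤ Mm₃) :
    ∑ r, |(S.thirdVec R u uθ B p τ s r : ℝ)| ≤ (B.card : ℝ) * P * (M₃ * (Xb : ℝ) ^ (∑ j, τ.2 j) * Mm₃) := by
  classical
  set Dn : ℕ := den₃ * S.bθ.natAbs ^ (∑ j, τ.2 j) * Dm₃ with hDn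
  have hb1 : 1 ≤ S.bθ.natAbs := Int.natAbs_pos.mpr S.bθ_ne
  have hDn1 : (1 : ℝ) ≤ Dn := by
    have : 1 ≤ Dn := one_le_mul (one_le_mul hden₃ (Nat.one_le_pow _ _ hb1)) hDm₃
    exact_mod_cast this
  set K : ℝ := (M₃ : ℝ) * (Xb : ℝ) ^ (∑ j, τ.2 j) * Mm₃ with hK
  have hl : ∀ r, |(S.thirdVec R u uθ B p τ s r : ℝ)| ≤
      ((B.filter (fun i => S.res3 (Fin.snoc (u i) (uθ i)) s = r)).card : ℝ) * P * K := by
    intro r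
    obtain ⟨z, hz, hzle⟩ := S.exists_int_clear_mul_thirdVec_gen R u uθ B p τ s hR hX hP hm₃ r
    have hzR : (Dn : ℝ) * (S.thirdVec R u uθ B p τ s r : ℝ) = (z : ℝ) := by
      have := congrArg (fun q : ℚ => (q : ℝ)) hz
      push_cast at this ⊢
      rw [hDn]; push_cast
      exact this
    have hzle' : |(z : ℝ)| ≤ ((B.filter (fun i => S.res3 (Fin.snoc (u i) (uθ i)) s = r)).card : ℝ) * P * K := by
      have := (Int.cast_le (R := ℝ)).mpr hzle
      push_cast at this
      rw [hK]
      linarith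
    calc |(S.thirdVec R u uθ B p τ s r : ℝ)| ≤ (Dn : ℝ) * |(S.thirdVec R u uθ B p τ s r : ℝ)| :=
          le_mul_of_one_le_left (abs_nonneg _) hDn1
      _ = |(z : ℝ)| := by rw [← hzR, abs_mul, Nat.abs_cast]
      _ ≤ _ := hzle'
  have hpart : ∑ r : Fin (S.d + 1) → Fin 3,
      ((B.filter (fun i => S.res3 (Fin.snoc (u i) (uθ i)) s = r)).card : ℝ) = B.card := by
    have h := Finset.card_eq_sum_card_fiberwise (s := B) (t := (Finset.univ : Finset (Fin (S.d + 1) → Fin 3)))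
      (f := fun i => S.res3 (Fin.snoc (u i) (uθ i)) s) (fun i _ => Finset.mem_univ _)
    rw [h]; push_cast; rfl
  calc ∑ r, |(S.thirdVec R u uθ B p τ s r : ℝ)|
      ≤ ∑ r, ((B.filter (fun i => S.res3 (Fin.snoc (u i) (uθ i)) s = r)).card : ℝ) * P * K :=
        Finset.sum_le_sum fun r _ => hl r
    _ = (∑ r, ((B.filter (fun i => S.res3 (Fin.snoc (u i) (uθ i)) s = r)).card : ℝ)) * P * K := by
        rw [Finset.sum_mul, Finset.sum_mul]
    _ = (B.card : ℝ) * P * K := by rw [hpart]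

/-! ### The datum from the virtual box -/

namespace SatData

variable {S} (F : S.SatData)

/-- The `αo`-box exponent of an arbitrary bound `W` on the virtual exponents: `⌈Wⱼ/N⌉`. [folklore] -/
def Eof (W : Fin (S.d + 1) → ℕ) : Fin (S.d + 1) → ℕ := fun j => (W j + F.N - 1) / F.N

/-- `Wⱼ ≤ N·⌈Wⱼ/N⌉`. [folklore] -/
theorem le_N_mul_Eof (W : Fin (S.d + 1) → ℕ) (j : Fin (S.d + 1)) : W j ≤ F.N * F.Eof W j := by
  unfold Eof
  have hN := F.hN
  have h := Nat.lt_div_mul_add (a := W j + F.N - 1) hN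
  rw [Nat.mul_comm F.N]
  omega

/-- `⌈Wⱼ/N⌉ ≤ Wⱼ/N + 1` (real form). [folklore] -/
theorem Eof_le (W : Fin (S.d + 1) → ℕ) (j : Fin (S.d + 1)) : (F.Eof W j : ℝ) ≤ (W j : ℝ) / F.N + 1 := by
  unfold Eof
  have hN := F.hN
  have hNr : (0 : ℝ) < F.N := by exact_mod_cast hN
  have h1 : ((W j + F.N - 1) / F.N : ℕ) * F.N ≤ W j + F.N - 1 := Nat.div_mul_le_self _ _
  have h2 : (((W j + F.N - 1) / F.N : ℕ) : ℝ) * F.N ≤ (W j : ℝ) + F.N := by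
    have h1' : (((W j + F.N - 1) / F.N * F.N : ℕ) : ℝ) ≤ ((W j + F.N - 1 : ℕ) : ℝ) := by exact_mod_cast h1
    have h3 : ((W j + F.N - 1 : ℕ) : ℝ) ≤ (W j : ℝ) + F.N := by
      have : W j + F.N - 1 ≤ W j + F.N := Nat.sub_le _ _
      exact_mod_cast this
    push_cast at h1'
    linarith
  rw [div_add_one hNr.ne', le_div_iff₀ hNr]
  linarith

/-- The clearing denominator of an arbitrary virtual bound `W`: `monDen αo ⌈W/N⌉`. [cite: Nesterenko2003, Lemma 3.11; shape only] -/
def DmOf (W : Fin (S.d + 1) → ℕ) : ℕ := MonomialDen.monDen F.αo (F.Eof W)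

/-- `1 ≤ DmOf`. [folklore] -/
theorem one_le_DmOf (W : Fin (S.d + 1) → ℕ) : 1 ≤ F.DmOf W := MonomialDen.one_le_monDen _ F.αo_ne _

/-- `log DmOf W ≤ 2·Σⱼ (Wⱼ/N + 1)·Vⱼ` for weights `h(αoⱼ) ≤ Vⱼ`. [cite: Nesterenko2003, Lemma 3.11; shape only] -/
theorem log_DmOf_le_of_weights (W : Fin (S.d + 1) → ℕ) (V : Fin (S.d + 1) → ℝ)
    (hV : ∀ j, Height.logHeight₁ (F.αo j) ≤ V j) :
    Real.log (F.DmOf W : ℝ) ≤ 2 * ∑ j, ((W j : ℝ) / F.N + 1) * V j := by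
  have h : Real.log (F.DmOf W : ℝ) ≤ 2 * ∑ j, (F.Eof W j : ℝ) * Height.logHeight₁ (F.αo j) :=
    MonomialDen.log_monDen_le _ F.αo_ne _
  have h2 : ∑ j, (F.Eof W j : ℝ) * Height.logHeight₁ (F.αo j) ≤ ∑ j, ((W j : ℝ) / F.N + 1) * V j := by
    refine Finset.sum_le_sum fun j _ => ?_
    exact mul_le_mul (F.Eof_le W j) (hV j) (Height.zero_le_logHeight₁ _) (by have := F.Eof_le W j; positivity)
  linarith

/-- **The virtual bound of the quotient vector `⌊κ s/3⌋` of the third step**: `(Bvⱼ·|s| + 2·Ucolⱼ)/3`.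
[cite: Nesterenko2003, §4.3 (4.42)–(4.44); shape only] -/
def W3 {n : ℕ} (Bv Ucol : Fin n → ℕ) (s : ℤ) : Fin n → ℕ :=
  fun j => (Bv j * s.natAbs + 2 * Ucol j) / 3

/-- **The quotient vector stays in the virtual bound `W3`**: if `|(κ ᵥ* U)ⱼ| ≤ Bvⱼ` and the α-coordinates of the
basis satisfy `Σₖ |U k j| ≤ Ucolⱼ`, then `|((⌊κₖ s/3⌋)ₖ ᵥ* U)ⱼ| ≤ (Bvⱼ·|s| + 2·Ucolⱼ)/3`
(`3·⌊κₖ s/3⌋ = κₖ s − rₖ`, `0 ≤ rₖ ≤ 2`). [cite: Nesterenko2003, §4.3 (4.50); shape only] -/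
theorem abs_vecMul_quot_le {Bv Ucol : Fin (S.d + 1) → ℕ} (hUcol : ∀ j, ∑ k, |F.U k j| ≤ (Ucol j : ℤ))
    {κ : Fin (S.d + 1) → ℤ} (hκ : ∀ j, |(κ ᵥ* F.U) j| ≤ (Bv j : ℤ)) (s : ℤ) (j : Fin (S.d + 1)) :
    |((fun k => κ k * s / 3) ᵥ* F.U) j| ≤ (W3 Bv Ucol s j : ℤ) := by
  -- `3·q = s·κ − r` with `r = κ s mod 3`
  set q : Fin (S.d + 1) → ℤ := fun k => κ k * s / 3 with hq
  set r : Fin (S.d + 1) → ℤ := fun k => κ k * s % 3 with hr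
  have hdecomp : ∀ k, 3 * q k = κ k * s - r k := by
    intro k
    have := Int.emod_add_mul_ediv (κ k * s) 3
    simp only [hq, hr]
    omega
  have hr0 : ∀ k, 0 ≤ r k := fun k => Int.emod_nonneg _ (by norm_num)
  have hr2 : ∀ k, r k ≤ 2 := fun k => by
    have := Int.emod_lt_of_pos (κ k * s) (by norm_num : (0 : ℤ) < 3)
    simp only [hr]; omega
  have h3 : 3 * (q ᵥ* F.U) j = s * (κ ᵥ* F.U) j - (r ᵥ* F.U) j := by
    simp only [Matrix.vecMul, dotProduct, Finset.mul_sum, ← Finset.sum_sub_distrib]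
    refine Finset.sum_congr rfl fun k _ => ?_
    rw [← mul_assoc, hdecomp k]
    ring
  have hrU : |(r ᵥ* F.U) j| ≤ 2 * ∑ k, |F.U k j| := by
    simp only [Matrix.vecMul, dotProduct]
    calc |∑ k, r k * F.U k j| ≤ ∑ k, |r k * F.U k j| := Finset.abs_sum_le_sum_abs _ _
      _ ≤ ∑ k, 2 * |F.U k j| := by
          refine Finset.sum_le_sum fun k _ => ?_
          rw [abs_mul, abs_of_nonneg (hr0 k)]
          exact mul_le_mul_of_nonneg_right (hr2 k) (abs_nonneg _)
      _ = 2 * ∑ k, |F.U k j| := by rw [Finset.mul_sum]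
  have hbound : 3 * |(q ᵥ* F.U) j| ≤ (Bv j : ℤ) * |s| + 2 * Ucol j := by
    have e : 3 * |(q ᵥ* F.U) j| = |3 * (q ᵥ* F.U) j| := by
      rw [abs_mul, abs_of_pos (by norm_num : (0 : ℤ) < 3)]
    rw [e, h3]
    calc |s * (κ ᵥ* F.U) j - (r ᵥ* F.U) j| ≤ |s * (κ ᵥ* F.U) j| + |(r ᵥ* F.U) j| := abs_sub _ _
      _ ≤ |s| * Bv j + 2 * Ucol j := by
          rw [abs_mul]
          exact add_le_add (mul_le_mul_of_nonneg_left (hκ j) (abs_nonneg _)) (hrU.trans (by linarith [hUcol j]))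
      _ = (Bv j : ℤ) * |s| + 2 * Ucol j := by ring
  unfold W3
  push_cast
  exact Int.le_ediv_of_mul_le (by norm_num) (by linarith)

/-- **`qPart3` cleared through the virtual box**: for `|(κ ᵥ* U)ⱼ| ≤ Bvⱼ` and `Σₖ |U k j| ≤ Ucolⱼ`,
`DmOf (W3 Bv Ucol s) · qPart3 κ s ∈ ℤ` with `|·| ≤ DmOf²`. [cite: Nesterenko2003, Lemma 3.11 and §4.3; shape only] -/
theorem exists_int_Dm3_mul_qPart3 {Bv Ucol : Fin (S.d + 1) → ℕ} (hUcol : ∀ j, ∑ k, |F.U k j| ≤ (Ucol j : ℤ))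
    {κ : Fin (S.d + 1) → ℤ} (hκ : ∀ j, |(κ ᵥ* F.U) j| ≤ (Bv j : ℤ)) (s : ℤ) :
    ∃ z : ℤ, ((F.DmOf (W3 Bv Ucol s) : ℕ) : ℚ) * S.qPart3 κ s = z ∧
      |z| ≤ ((F.DmOf (W3 Bv Ucol s) : ℤ)) ^ 2 := by
  have hbox : ∀ j, |((fun k => κ k * s / 3) ᵥ* F.U) j| ≤ (F.N : ℤ) * (F.Eof (W3 Bv Ucol s) j : ℕ) := by
    intro j
    refine (F.abs_vecMul_quot_le hUcol hκ s j).trans ?_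
    exact_mod_cast F.le_N_mul_Eof (W3 Bv Ucol s) j
  unfold qPart3 DmOf
  exact SatCoords.exists_int_monDen_mul_prod_zpow_sat F.αo S.toQ.all F.U F.N F.hαo F.hall F.hN F.hU
    (F.Eof (W3 Bv Ucol s)) _ hbox

/-- **The `qPart3` datum of a family in the virtual box** (the hypothesis `hm₃` of `sum_abs_thirdVec_le_gen`, with
`Dm₃ = DmOf (W3 Bv Ucol s)`, `Mm₃ = Dm₃²`). [cite: Nesterenko2003, Lemma 3.11 and §4.3; shape only] -/
theorem thirdDatum_of_vbox {ι : Type*} {u : ι → Fin S.d → ℤ} {uθ : ι → ℤ} {B : Finset ι}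
    {Bv Ucol : Fin (S.d + 1) → ℕ} (hUcol : ∀ j, ∑ k, |F.U k j| ≤ (Ucol j : ℤ))
    (hκ : ∀ i ∈ B, ∀ j, |(S.allκ u uθ i ᵥ* F.U) j| ≤ (Bv j : ℤ)) (s : ℤ) :
    ∀ i ∈ B, ∃ z₂ : ℤ, ((F.DmOf (W3 Bv Ucol s) : ℕ) : ℚ) * S.qPart3 (Fin.snoc (u i) (uθ i)) s = z₂ ∧
      |z₂| ≤ ((F.DmOf (W3 Bv Ucol s) : ℤ)) ^ 2 :=
  fun i hi => F.exists_int_Dm3_mul_qPart3 hUcol (hκ i hi) s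

end SatData

end TwoSetup

end Summit.ABC.StewartYu

end
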